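import Summits.AtomisticToContinuum.Crystallization.Theorems.ChartedZeroExcessLayeredLatticeLiouvilleZZZYRCL

/-!
# Charted zero-excess layered-lattice Liouville — ZZZYRCP: routing multiplicity by TRANSLATION EQUIVARIANCE; the KING index path system

Cell `decomp-a2c`, lens 2, generation 99.  Critic r1822 on ZZZYRCL's remainder lemma: «hM (multiplicity) is the count the K-file must PROVE for
its path system — provide `card_routing_le` generically or state precisely what the K-file proves».  Answer:

* ★ `card_routing_le_of_equivariant` — for a path system EQUIVARIANT under a subgroup `H` of index translations (`z (x + t) i = z x i + t`,
  `t ∈ H`; the index set `Cell 2 × ℤ ≅ ℤ³` is a group although the layered SITES are not a lattice; `H = ⊤` for rules depending on the index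
  difference only, `H` = period lattice of the decoded word for residue-dependent rules), the pairs of a finite family in one `H`-coset routed
  through a fixed pair `y` at a position `< n` with index difference in a finite `S` number `≤ n · #S`: `x ↦ (x.2 − x.1, first position at y)` is
  injective.  No packing, no geometry.  (The K-file sums over the finitely many cosets.)
* ★ the KING PATH SYSTEM `kingN`, `kingZ` (every coordinate of the index difference moves one unit per step towards its target) — the template
  instance with EVERY hypothesis of `schemeDominatedOnP_remainder` (ZZZYRCL) discharged for every layered crystal (`IsLayeredCrystal c₀`, word
  Lipschitz `ℓ₀`, `‖a‖ + ‖b‖ + ℓ₀ ≤ ϱ`): path system (`isPathSystem_king`), simple (`king_simple`), quasi-geodesic with the crystal's own constant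
  (`king_quasi : c₀ · kingN x ≤ ‖e_x‖` — `IsLayeredCrystal` IS the lower Lipschitz bound from the sup-metric index distance), equivariant
  (`kingZ_add`), differences in the index shell (`card_shell_le : #shell n ≤ 24n² + 2`) ⇒ multiplicity `≤ n (24n² + 2)` (`king_multiplicity`), far
  coefficient `≤ 7 n / max(D, c₀ n)⁸` (`king_coef_le`) ⇒ ★ `schemeDominatedOnP_remainder_king`: on `{D < ‖e‖}` the constant tables `(1+α) θ`,
  `(1+α⁻¹) θ` dominate once `Σ_{n ∈ [nD, N)} n (24n²+2) · 7 n / max(D, c₀ n)⁸ ≤ θ` (all `N`; `nD − 1 ≤ D/ϱ`) — pure series arithmetic for the K-file.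

Provable sizes (memo NODE-g99 §8.6; `ϱ = 4`, `c₀ = 0.74 / 0.80`): king `θ(D) = 1.2e-2 / 8.4e-3 (D = 32)`, `3.7e-3 / 2.5e-3 (48)`, `1.5e-3 / 1.0e-3 (64)`
(× `(1+α)` resp. `(1+α⁻¹)`): exact multiplicity, pessimistic length (pieces ≈ 1 instead of ≈ 3).  An equivariant LONG-JUMP `Δ`-rule (pieces of
physical length ≈ 3 like the is99 census paths, but defined on index differences and residues) gets `≈ 5e-4 (1+α)` at `D = 32` from the SAME lemma;
the physical nearest-site paths have true load «a few 1e-4» (census l.9567) but a provable multiplicity only through packing (≈ 20×).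
Theorem file (6 defs `kpos` `kvec` `kingZ` `kingN` `cube` `shell`, 27 theorems); imports ZZZYRCL; no instance / notation / option; 0 sorry. [g99]
-/

open scoped BigOperators
namespace Summit.AtomisticToContinuum.Crystallization.Theorems.ChartedZeroExcessLayeredLatticeLiouville

open Summit.AtomisticToContinuum.Crystallization.Theorems.ChartedPlanarOrderRigidityDoor (E3)

/-! ### §1 Multiplicity by translation equivariance -/

/-- ★ **ROUTING MULTIPLICITY FOR EQUIVARIANT PATH SYSTEMS**: `H` a subgroup of index translations (all of `Cell 2 × ℤ ≅ ℤ³`, or the period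
lattice of a decoded word) with `z (x.1 + t, x.2 + t) i = z x i + t` for `t ∈ H`; then the pairs of a finite family in ONE `H`-coset (by first
index), routed through the fixed pair `y` at a position `< n`, with index difference in the finite `S`, number `≤ n · #S`: `x ↦ (x.2 − x.1, first
position at y)` is injective (same difference ⇒ `H`-translates; equivariance moves the node; the node is pinned at `y.1`).  No packing. [g99] -/
theorem card_routing_le_of_equivariant {z : (Cell 2 × ℤ) × (Cell 2 × ℤ) → ℕ → Cell 2 × ℤ} (H : AddSubgroup (Cell 2 × ℤ))
    (hequi : ∀ (x : (Cell 2 × ℤ) × (Cell 2 × ℤ)) (t : Cell 2 × ℤ), t ∈ H → ∀ i : ℕ, z (x.1 + t, x.2 + t) i = z x i + t)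
    {n : ℕ} {y : (Cell 2 × ℤ) × (Cell 2 × ℤ)} (S : Finset (Cell 2 × ℤ)) (Y : Finset ((Cell 2 × ℤ) × (Cell 2 × ℤ)))
    (hcos : ∀ x ∈ Y, ∀ x' ∈ Y, x'.1 - x.1 ∈ H)
    (hY : ∀ x ∈ Y, x.2 - x.1 ∈ S ∧ ∃ i < n, piece z x i = y) : Y.card ≤ n * S.card := by
  classical
  let pos : (Cell 2 × ℤ) × (Cell 2 × ℤ) → ℕ := fun x => if h : ∃ i, i < n ∧ piece z x i = y then Nat.find h else 0
  have hpos : ∀ x ∈ Y, pos x < n ∧ piece z x (pos x) = y := by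
    intro x hx
    obtain ⟨-, i, hi, hy⟩ := hY x hx
    have h : ∃ i, i < n ∧ piece z x i = y := ⟨i, hi, hy⟩
    have hp : pos x = Nat.find h := by simp only [pos, dif_pos h]
    rw [hp]
    exact Nat.find_spec h
  have hmaps : Set.MapsTo (fun x => (x.2 - x.1, pos x)) (Y : Set ((Cell 2 × ℤ) × (Cell 2 × ℤ)))
      ((S ×ˢ Finset.range n : Finset ((Cell 2 × ℤ) × ℕ)) : Set ((Cell 2 × ℤ) × ℕ)) := fun x hx =>
    Finset.mem_coe.mpr (Finset.mem_product.mpr ⟨(hY x hx).1, Finset.mem_range.mpr (hpos x hx).1⟩)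
  have hinj : Set.InjOn (fun x => (x.2 - x.1, pos x)) (Y : Set ((Cell 2 × ℤ) × (Cell 2 × ℤ))) := by
    intro x hx x' hx' hxx'
    simp only [Prod.mk.injEq] at hxx'
    obtain ⟨hΔ, hp⟩ := hxx'
    have h1 : z x (pos x) = y.1 := congrArg Prod.fst (hpos x hx).2
    have h2 : z x' (pos x) = y.1 := by rw [hp]; exact congrArg Prod.fst (hpos x' hx').2
    set t := x'.1 - x.1 with ht
    have htH : t ∈ H := hcos x hx x' hx'
    have hx'eq : x' = (x.1 + t, x.2 + t) := by
      refine Prod.ext ?_ ?_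
      · show x'.1 = x.1 + t
        rw [ht, add_sub_cancel]
      · show x'.2 = x.2 + t
        have e : x'.2 = x'.2 - x'.1 + x'.1 := (sub_add_cancel _ _).symm
        rw [e, ← hΔ, ht]; abel
    have h3 := hequi x t htH (pos x)
    rw [← hx'eq, h2, h1] at h3
    have ht0 : t = 0 := by
      have := congrArg (fun u => u - y.1) h3
      simpa using this.symm
    rw [hx'eq, ht0, add_zero, add_zero]
  calc Y.card ≤ (S ×ˢ Finset.range n).card := Finset.card_le_card_of_injOn _ hmaps hinj
    _ = n * S.card := by rw [Finset.card_product, Finset.card_range, mul_comm]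

/-! ### §2 The king path system -/

/-- position of one coordinate after `i` king steps towards the target difference `d`: `sign d · min(i, |d|)`. [g99] -/
def kpos (d : ℤ) (i : ℕ) : ℤ := Int.sign d * min (i : ℤ) (d.natAbs : ℤ)

/-- the index vector after `i` king steps towards the difference `Δ`. [g99] -/
def kvec (Δ : Cell 2 × ℤ) (i : ℕ) : Cell 2 × ℤ := (fun k => kpos (Δ.1 k) i, kpos Δ.2 i)

/-- **KING PATH**: node `i` of the path of the ordered pair `x` is `x.1 + kvec (x.2 − x.1) i`. [g99] -/
def kingZ (x : (Cell 2 × ℤ) × (Cell 2 × ℤ)) (i : ℕ) : Cell 2 × ℤ := x.1 + kvec (x.2 - x.1) i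

/-- **KING LENGTH**: number of pieces = sup norm of the index difference. [g99] -/
def kingN (x : (Cell 2 × ℤ) × (Cell 2 × ℤ)) : ℕ :=
  max (max ((x.2 - x.1).1 0).natAbs ((x.2 - x.1).1 1).natAbs) (x.2 - x.1).2.natAbs

/-- `kpos d 0 = 0`. [g99] -/
theorem kpos_zero (d : ℤ) : kpos d 0 = 0 := by simp [kpos]

/-- after `|d|` steps the coordinate has arrived: `kpos d i = d` for `|d| ≤ i`. [g99] -/
theorem kpos_of_le {d : ℤ} {i : ℕ} (h : d.natAbs ≤ i) : kpos d i = d := by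
  unfold kpos
  rw [min_eq_right (by exact_mod_cast h)]
  exact Int.sign_mul_natAbs d

/-- the step of one coordinate: `sign d` while `i < |d|`, `0` afterwards. [g99] -/
theorem kpos_succ_sub (d : ℤ) (i : ℕ) : kpos d (i + 1) - kpos d i = if i < d.natAbs then Int.sign d else 0 := by
  unfold kpos
  split_ifs with h
  · have h1 : ((i + 1 : ℕ) : ℤ) ≤ (d.natAbs : ℤ) := by exact_mod_cast h
    have h2 : ((i : ℕ) : ℤ) ≤ (d.natAbs : ℤ) := by exact_mod_cast h.le
    rw [min_eq_left h1, min_eq_left h2]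
    push_cast
    ring
  · have h1 : (d.natAbs : ℤ) ≤ ((i + 1 : ℕ) : ℤ) := by exact_mod_cast (show d.natAbs ≤ i + 1 by omega)
    have h2 : (d.natAbs : ℤ) ≤ ((i : ℕ) : ℤ) := by exact_mod_cast (not_lt.mp h)
    rw [min_eq_right h1, min_eq_right h2]
    ring

/-- one coordinate moves by at most one unit per step. [g99] -/
theorem natAbs_kpos_succ_sub_le (d : ℤ) (i : ℕ) : (kpos d (i + 1) - kpos d i).natAbs ≤ 1 := by
  rw [kpos_succ_sub]
  split_ifs
  · rcases lt_trichotomy d 0 with h | h | h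
    · simp [Int.sign_eq_neg_one_of_neg h]
    · simp [h]
    · simp [Int.sign_eq_one_of_pos h]
  · simp

/-- while `i < |d|` the positions `kpos d i` are pairwise distinct (the moving coordinate is strictly monotone). [g99] -/
theorem kpos_injOn {d : ℤ} {i j : ℕ} (hi : i ≤ d.natAbs) (hj : j ≤ d.natAbs) (hd : d ≠ 0) (h : kpos d i = kpos d j) : i = j := by
  unfold kpos at h
  rw [min_eq_left (by exact_mod_cast hi), min_eq_left (by exact_mod_cast hj)] at h
  have hs : Int.sign d ≠ 0 := fun h0 => hd (Int.sign_eq_zero_iff_zero.mp h0)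
  exact_mod_cast mul_left_cancel₀ hs h

/-- the king path starts at `x.1`. [g99] -/
theorem kingZ_zero (x : (Cell 2 × ℤ) × (Cell 2 × ℤ)) : kingZ x 0 = x.1 := by
  have : kvec (x.2 - x.1) 0 = 0 := Prod.ext (funext fun k => kpos_zero _) (kpos_zero _)
  rw [kingZ, this, add_zero]

/-- the king path ends at `x.2` after `kingN x` steps. [g99] -/
theorem kingZ_kingN (x : (Cell 2 × ℤ) × (Cell 2 × ℤ)) : kingZ x (kingN x) = x.2 := by
  have h : kvec (x.2 - x.1) (kingN x) = x.2 - x.1 := by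
    refine Prod.ext (funext fun k => kpos_of_le ?_) (kpos_of_le ?_)
    · fin_cases k
      · exact (le_max_left _ _).trans (le_max_left _ _)
      · exact (le_max_right _ _).trans (le_max_left _ _)
    · exact le_max_right _ _
  rw [kingZ, h, add_sub_cancel]

/-- ★ **EQUIVARIANCE**: translating both ends of the pair translates every node. [g99] -/
theorem kingZ_add (x : (Cell 2 × ℤ) × (Cell 2 × ℤ)) (t : Cell 2 × ℤ) (i : ℕ) : kingZ (x.1 + t, x.2 + t) i = kingZ x i + t := by
  simp only [kingZ, add_sub_add_right_eq_sub]
  exact add_right_comm _ _ _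

/-- before the end (`i < kingN x`) consecutive nodes differ (some coordinate is still moving). [g99] -/
theorem kingZ_succ_ne {x : (Cell 2 × ℤ) × (Cell 2 × ℤ)} {i : ℕ} (hi : i < kingN x) : kingZ x (i + 1) ≠ kingZ x i := by
  intro h
  have hv : kvec (x.2 - x.1) (i + 1) = kvec (x.2 - x.1) i := add_left_cancel (a := x.1) h
  -- a coordinate with `i < |Δ_k|` moves by `sign Δ_k ≠ 0`
  have key : ∀ d : ℤ, i < d.natAbs → kpos d (i + 1) = kpos d i → False := by
    intro d hd he
    have h1 := kpos_succ_sub d i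
    rw [he, sub_self, if_pos hd] at h1
    have hd0 : d ≠ 0 := by intro h0; rw [h0] at hd; simp at hd
    exact hd0 (Int.sign_eq_zero_iff_zero.mp h1.symm)
  unfold kingN at hi
  rcases lt_max_iff.mp hi with h01 | h2
  · rcases lt_max_iff.mp h01 with h0 | h1
    · exact key _ h0 (congrFun (congrArg Prod.fst hv) 0)
    · exact key _ h1 (congrFun (congrArg Prod.fst hv) 1)
  · exact key _ h2 (congrArg Prod.snd hv)

/-- ★ **SIMPLE**: the king path visits pairwise distinct nodes up to its end, hence repeats no piece. [g99] -/
theorem king_simple (x : (Cell 2 × ℤ) × (Cell 2 × ℤ)) {i j : ℕ} (hi : i < kingN x) (hj : j < kingN x)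
    (h : piece kingZ x i = piece kingZ x j) : i = j := by
  have hz : kvec (x.2 - x.1) i = kvec (x.2 - x.1) j := add_left_cancel (a := x.1) (congrArg Prod.fst h)
  -- use the coordinate realising the maximum
  have key : ∀ d : ℤ, d.natAbs = kingN x → kpos d i = kpos d j → i = j := by
    intro d hd he
    have hd0 : d ≠ 0 := by intro h0; rw [h0] at hd; simp at hd; omega
    exact kpos_injOn (hd ▸ hi.le) (hd ▸ hj.le) hd0 he
  have hmax : ((x.2 - x.1).1 0).natAbs = kingN x ∨ ((x.2 - x.1).1 1).natAbs = kingN x ∨ (x.2 - x.1).2.natAbs = kingN x := by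
    unfold kingN; omega
  rcases hmax with h0 | h1 | h2
  · exact key _ h0 (congrFun (congrArg Prod.fst hz) 0)
  · exact key _ h1 (congrFun (congrArg Prod.fst hz) 1)
  · exact key _ h2 (congrArg Prod.snd hz)

/-- an integer of absolute value `≤ 1` casts to a real of absolute value `≤ 1`. [g99] -/
theorem abs_cast_le_one {n : ℤ} (h : n.natAbs ≤ 1) : |(n : ℝ)| ≤ 1 := by
  rw [← Int.cast_abs]
  exact_mod_cast (abs_le.mpr ⟨by omega, by omega⟩ : |n| ≤ 1)

/-- the layered site difference across one king step is at most `‖a‖ + ‖b‖ + ℓ₀` (each in-plane index moves by `≤ 1`, the layer by `≤ 1`). [g99] -/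
theorem norm_lsite_sub_lsite_le_lip {a b : E3} {w : ℤ → E3} {ℓ₀ : ℝ} (hlip : ∀ m : ℤ, ‖w (m + 1) - w m‖ ≤ ℓ₀)
    {u v : Cell 2 × ℤ} (h0 : (v.1 0 - u.1 0).natAbs ≤ 1) (h1 : (v.1 1 - u.1 1).natAbs ≤ 1) (h2 : (v.2 - u.2).natAbs ≤ 1) :
    ‖lsite a b w v.1 v.2 - lsite a b w u.1 u.2‖ ≤ ‖a‖ + ‖b‖ + ℓ₀ := by
  have hℓ : 0 ≤ ℓ₀ := (norm_nonneg _).trans (hlip 0)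
  have hexp : lsite a b w v.1 v.2 - lsite a b w u.1 u.2 =
      (((v.1 0 - u.1 0 : ℤ) : ℝ) • a + ((v.1 1 - u.1 1 : ℤ) : ℝ) • b) + (w v.2 - w u.2) := by
    simp only [lsite, Int.cast_sub, sub_smul]; abel
  have hw : ‖w v.2 - w u.2‖ ≤ ℓ₀ := by
    have hc : v.2 = u.2 - 1 ∨ v.2 = u.2 ∨ v.2 = u.2 + 1 := by omega
    rcases hc with h | h | h
    · rw [h, norm_sub_rev]
      have := hlip (u.2 - 1); rwa [sub_add_cancel] at this
    · rw [h, sub_self, norm_zero]; exact hℓ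
    · rw [h]; exact hlip u.2
  have hca : ‖((v.1 0 - u.1 0 : ℤ) : ℝ) • a‖ ≤ ‖a‖ := by
    rw [norm_smul, Real.norm_eq_abs]
    exact mul_le_of_le_one_left (norm_nonneg _) (abs_cast_le_one h0)
  have hcb : ‖((v.1 1 - u.1 1 : ℤ) : ℝ) • b‖ ≤ ‖b‖ := by
    rw [norm_smul, Real.norm_eq_abs]
    exact mul_le_of_le_one_left (norm_nonneg _) (abs_cast_le_one h1)
  rw [hexp]
  calc ‖(((v.1 0 - u.1 0 : ℤ) : ℝ) • a + ((v.1 1 - u.1 1 : ℤ) : ℝ) • b) + (w v.2 - w u.2)‖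
      ≤ ‖((v.1 0 - u.1 0 : ℤ) : ℝ) • a + ((v.1 1 - u.1 1 : ℤ) : ℝ) • b‖ + ‖w v.2 - w u.2‖ := norm_add_le _ _
    _ ≤ (‖((v.1 0 - u.1 0 : ℤ) : ℝ) • a‖ + ‖((v.1 1 - u.1 1 : ℤ) : ℝ) • b‖) + ‖w v.2 - w u.2‖ := by
        gcongr; exact norm_add_le _ _
    _ ≤ (‖a‖ + ‖b‖) + ℓ₀ := by gcongr

/-- coordinates of consecutive king nodes differ by the coordinate step. [g99] -/
theorem kingZ_succ_sub (x : (Cell 2 × ℤ) × (Cell 2 × ℤ)) (i : ℕ) :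
    (∀ k, (kingZ x (i + 1)).1 k - (kingZ x i).1 k = kpos ((x.2 - x.1).1 k) (i + 1) - kpos ((x.2 - x.1).1 k) i) ∧
      (kingZ x (i + 1)).2 - (kingZ x i).2 = kpos (x.2 - x.1).2 (i + 1) - kpos (x.2 - x.1).2 i := by
  refine ⟨fun k => ?_, ?_⟩
  · simp only [kingZ, kvec, Prod.fst_add, Pi.add_apply]; ring
  · simp only [kingZ, kvec, Prod.snd_add]; ring

/-- ★ **THE KING PATHS ARE A PATH SYSTEM** for every layered crystal with Lipschitz word, as soon as `‖a‖ + ‖b‖ + ℓ₀ ≤ ϱ`: pieces have length in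
`[c₀, ‖a‖ + ‖b‖ + ℓ₀] ⊆ (0, ϱ]`. [g99] -/
theorem isPathSystem_king {c₀ ϱ ℓ₀ : ℝ} (hc : 0 < c₀) {a b : E3} {w : ℤ → E3} (hw : IsLayeredCrystal c₀ a b w)
    (hlip : ∀ m : ℤ, ‖w (m + 1) - w m‖ ≤ ℓ₀) (hϱ : ‖a‖ + ‖b‖ + ℓ₀ ≤ ϱ) : IsPathSystem ϱ a b w kingN kingZ := by
  intro x _
  refine ⟨kingZ_zero x, kingZ_kingN x, fun i hi => ?_⟩
  have hb : bondVec a b w (piece kingZ x i) = lsite a b w (kingZ x (i + 1)).1 (kingZ x (i + 1)).2 -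
      lsite a b w (kingZ x i).1 (kingZ x i).2 := rfl
  constructor
  · have h1 := hw (kingZ x (i + 1)) (kingZ x i)
    have h2 := one_le_dist_of_ne (kingZ_succ_ne hi)
    rw [hb]
    calc (0 : ℝ) < c₀ * 1 := by linarith
      _ ≤ c₀ * dist (kingZ x (i + 1)) (kingZ x i) := mul_le_mul_of_nonneg_left h2 hc.le
      _ ≤ _ := h1
  · obtain ⟨hf, hs⟩ := kingZ_succ_sub x i
    rw [hb]
    refine (norm_lsite_sub_lsite_le_lip hlip ?_ ?_ ?_).trans hϱ
    · rw [hf 0]; exact natAbs_kpos_succ_sub_le _ _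
    · rw [hf 1]; exact natAbs_kpos_succ_sub_le _ _
    · rw [hs]; exact natAbs_kpos_succ_sub_le _ _

/-- the sup-metric index distance dominates every coordinate difference, hence `kingN x ≤ dist x.1 x.2`. [g99] -/
theorem kingN_le_dist (x : (Cell 2 × ℤ) × (Cell 2 × ℤ)) : (kingN x : ℝ) ≤ dist x.1 x.2 := by
  have hk : ∀ k, (((x.2 - x.1).1 k).natAbs : ℝ) ≤ dist x.1 x.2 := fun k => by
    rw [Nat.cast_natAbs, Prod.dist_eq]
    refine le_trans ?_ (le_max_left _ _)
    refine le_trans (le_of_eq ?_) (dist_le_pi_dist x.1.1 x.2.1 k)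
    rw [Int.dist_eq, abs_sub_comm]
    simp
  have h2 : (((x.2 - x.1).2).natAbs : ℝ) ≤ dist x.1 x.2 := by
    rw [Nat.cast_natAbs, Prod.dist_eq]
    refine le_trans (le_of_eq ?_) (le_max_right _ _)
    rw [Int.dist_eq, abs_sub_comm]
    simp
  unfold kingN
  push_cast
  exact max_le (max_le (hk 0) (hk 1)) h2

/-- ★ **QUASI-GEODESIC WITH THE CRYSTAL'S CONSTANT**: `c₀ · kingN x ≤ ‖e_x‖` (`IsLayeredCrystal c₀` is exactly the lower Lipschitz bound from the
sup-metric index distance to space). [g99] -/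
theorem king_quasi {c₀ : ℝ} (hc : 0 ≤ c₀) {a b : E3} {w : ℤ → E3} (hw : IsLayeredCrystal c₀ a b w)
    (x : (Cell 2 × ℤ) × (Cell 2 × ℤ)) : c₀ * (kingN x : ℝ) ≤ ‖bondVec a b w x‖ := by
  have h1 := hw x.1 x.2
  rw [norm_sub_rev] at h1
  exact (mul_le_mul_of_nonneg_left (kingN_le_dist x) hc).trans h1

/-- the index cube `[-n, n]³`. [g99] -/
noncomputable def cube (n : ℕ) : Finset (Cell 2 × ℤ) :=
  (Fintype.piFinset fun _ : Fin 2 => Finset.Icc (-(n : ℤ)) n) ×ˢ Finset.Icc (-(n : ℤ)) n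

/-- a pair of king length `≤ n` has its index difference in the cube. [g99] -/
theorem sub_mem_cube_of_kingN_le {x : (Cell 2 × ℤ) × (Cell 2 × ℤ)} {n : ℕ} (h : kingN x ≤ n) : x.2 - x.1 ∈ cube n := by
  have h0 : ((x.2 - x.1).1 0).natAbs ≤ n := (le_max_left _ _).trans ((le_max_left _ _).trans h)
  have h1 : ((x.2 - x.1).1 1).natAbs ≤ n := (le_max_right _ _).trans ((le_max_left _ _).trans h)
  have h2 : ((x.2 - x.1).2).natAbs ≤ n := (le_max_right _ _).trans h
  clear h
  simp only [cube, Finset.mem_product, Fintype.mem_piFinset, Finset.mem_Icc]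
  refine ⟨fun k => ?_, by omega, by omega⟩
  fin_cases k
  · exact (⟨by omega, by omega⟩ : -(n : ℤ) ≤ (x.2 - x.1).1 0 ∧ (x.2 - x.1).1 0 ≤ n)
  · exact (⟨by omega, by omega⟩ : -(n : ℤ) ≤ (x.2 - x.1).1 1 ∧ (x.2 - x.1).1 1 ≤ n)

/-- `#cube n = (2n+1)³`. [g99] -/
theorem card_cube (n : ℕ) : (cube n).card = (2 * n + 1) ^ 3 := by
  have h : (Finset.Icc (-(n : ℤ)) n).card = 2 * n + 1 := by
    rw [Int.card_Icc]; omega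
  rw [cube, Finset.card_product, Fintype.card_piFinset, Finset.prod_const, Finset.card_univ, Fintype.card_fin, h]
  ring

/-- conversely, an index difference in `cube k` has king length `≤ k`. [g99] -/
theorem kingN_le_of_sub_mem_cube {x : (Cell 2 × ℤ) × (Cell 2 × ℤ)} {k : ℕ} (h : x.2 - x.1 ∈ cube k) : kingN x ≤ k := by
  simp only [cube, Finset.mem_product, Fintype.mem_piFinset, Finset.mem_Icc] at h
  obtain ⟨hk, h2a, h2b⟩ := h
  obtain ⟨h0a, h0b⟩ := hk 0
  obtain ⟨h1a, h1b⟩ := hk 1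
  unfold kingN
  refine max_le (max_le ?_ ?_) ?_ <;> omega

/-- the cubes are nested. [g99] -/
theorem cube_mono {k k' : ℕ} (h : k ≤ k') : cube k ⊆ cube k' := by
  intro Δ hΔ
  simp only [cube, Finset.mem_product, Fintype.mem_piFinset, Finset.mem_Icc] at hΔ ⊢
  obtain ⟨hk, h2a, h2b⟩ := hΔ
  refine ⟨fun j => ?_, by omega, by omega⟩
  obtain ⟨ha, hb⟩ := hk j
  constructor <;> omega

/-- the index SHELL `{|Δ|∞ = n}` (`= cube n ∖ cube (n−1)` for `n ≥ 1`, `= {0}` for `n = 0`). [g99] -/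
noncomputable def shell (n : ℕ) : Finset (Cell 2 × ℤ) := if n = 0 then cube 0 else cube n \ cube (n - 1)

/-- a pair of king length `n` has its index difference in the shell. [g99] -/
theorem sub_mem_shell_of_kingN_eq {x : (Cell 2 × ℤ) × (Cell 2 × ℤ)} {n : ℕ} (h : kingN x = n) : x.2 - x.1 ∈ shell n := by
  unfold shell
  split_ifs with hn
  · exact sub_mem_cube_of_kingN_le (h.le.trans hn.le)
  · rw [Finset.mem_sdiff]
    refine ⟨sub_mem_cube_of_kingN_le h.le, fun hmem => ?_⟩
    have := kingN_le_of_sub_mem_cube hmem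
    omega

/-- `#shell n ≤ 24 n² + 2` (equality for `n ≥ 1`: `(2n+1)³ − (2n−1)³`). [g99] -/
theorem card_shell_le (n : ℕ) : ((shell n).card : ℝ) ≤ 24 * (n : ℝ) ^ 2 + 2 := by
  unfold shell
  split_ifs with hn
  · subst hn; rw [card_cube]; norm_num
  · have hsub : cube (n - 1) ⊆ cube n := cube_mono (Nat.sub_le n 1)
    rw [Finset.card_sdiff_of_subset hsub, card_cube, card_cube]
    have h1 : 1 ≤ n := Nat.one_le_iff_ne_zero.mpr hn
    have e : (2 * n + 1) ^ 3 - (2 * (n - 1) + 1) ^ 3 = 24 * n ^ 2 + 2 := by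
      obtain ⟨k, rfl⟩ := Nat.exists_eq_add_of_le h1
      simp only [Nat.add_sub_cancel_left]
      ring_nf
      omega
    rw [e]
    push_cast
    exact le_refl _

/-- ★ **KING MULTIPLICITY**: at most `n (24 n² + 2)` pairs of king length `n` of any finite family are routed through a fixed pair
(`card_routing_le_of_equivariant` with all index translations and `S = shell n`). [g99] -/
theorem king_multiplicity (y : (Cell 2 × ℤ) × (Cell 2 × ℤ)) (n : ℕ) (Y : Finset ((Cell 2 × ℤ) × (Cell 2 × ℤ)))
    (hY : ∀ x ∈ Y, kingN x = n ∧ ∃ i < kingN x, piece kingZ x i = y) : (Y.card : ℝ) ≤ (n : ℝ) * (24 * (n : ℝ) ^ 2 + 2) := by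
  have h := card_routing_le_of_equivariant (z := kingZ) (n := n) (y := y) ⊤ (fun x t _ i => kingZ_add x t i) (shell n) Y
    (fun _ _ _ _ => AddSubgroup.mem_top _) fun x hx => by
    obtain ⟨hn, i, hi, hpi⟩ := hY x hx
    exact ⟨sub_mem_shell_of_kingN_eq hn, i, hn ▸ hi, hpi⟩
  have h' : (Y.card : ℝ) ≤ (n : ℝ) * ((shell n).card : ℝ) := by exact_mod_cast h
  exact h'.trans (mul_le_mul_of_nonneg_left (card_shell_le n) (Nat.cast_nonneg _))

/-- `a₋(r) ≤ 7 / r⁸`. [g99] -/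
theorem aMinus_le_div (r : ℝ) : aMinus r ≤ 7 / r ^ 8 := by
  have h1 : 0 ≤ 7 / r ^ 8 := by positivity
  have h2 : 0 ≤ 13 / r ^ 14 := by positivity
  exact max_le h1 (by linarith)

/-- ★ **FAR COEFFICIENT OF A KING PATH**: on the class `D < ‖e_x‖`, `kingN x · a₋(‖e_x‖) ≤ 7 · kingN x / max(D, c₀ · kingN x)⁸`. [g99] -/
theorem king_coef_le {c₀ D : ℝ} (hc : 0 ≤ c₀) {a b : E3} {w : ℤ → E3} (hw : IsLayeredCrystal c₀ a b w) (hD : 0 < D)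
    {x : (Cell 2 × ℤ) × (Cell 2 × ℤ)} (hDx : D < ‖bondVec a b w x‖) :
    (kingN x : ℝ) * aMinus ‖bondVec a b w x‖ ≤ 7 * (kingN x : ℝ) / max D (c₀ * kingN x) ^ 8 := by
  set m := max D (c₀ * kingN x) with hm
  have hm0 : 0 < m := lt_max_of_lt_left hD
  have hmr : m ≤ ‖bondVec a b w x‖ := max_le hDx.le (king_quasi hc hw x)
  have h1 : aMinus ‖bondVec a b w x‖ ≤ 7 / m ^ 8 :=
    (aMinus_le_div _).trans (div_le_div_of_nonneg_left (by norm_num) (by positivity) (pow_le_pow_left₀ hm0.le hmr 8))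
  calc (kingN x : ℝ) * aMinus ‖bondVec a b w x‖ ≤ (kingN x : ℝ) * (7 / m ^ 8) :=
        mul_le_mul_of_nonneg_left h1 (Nat.cast_nonneg _)
    _ = 7 * (kingN x : ℝ) / m ^ 8 := by ring

/-- ★★ **THE REMAINDER LEMMA FOR KING PATHS**: for every layered crystal with Lipschitz word and `‖a‖ + ‖b‖ + ℓ₀ ≤ ϱ`, on the class `D < ‖e‖` the
constant tables `(1+α) θ`, `(1+α⁻¹) θ` dominate the king scheme as soon as the explicit series is bounded:
`Σ_{n ∈ [nD, N)} n (24n²+2) · 7 n / max(D, c₀ n)⁸ ≤ θ` for all `N`, with `nD − 1 ≤ D / ϱ`.  Every other hypothesis of ZZZYRCL's remainder lemma is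
discharged here (simple: `king_simple`; class floor: `lt_np_of_pathSystem`; coefficient: `king_coef_le`; multiplicity: `king_multiplicity`). [g99] -/
theorem schemeDominatedOnP_remainder_king {c₀ ϱ ℓ₀ α D θ : ℝ} (hα : 0 < α) (hc : 0 < c₀) {a b : E3} {w : ℤ → E3}
    (hw : IsLayeredCrystal c₀ a b w) (hlip : ∀ m : ℤ, ‖w (m + 1) - w m‖ ≤ ℓ₀) (hϱ : ‖a‖ + ‖b‖ + ℓ₀ ≤ ϱ) (hϱ0 : 0 < ϱ) (hD : 0 < D)
    {nD : ℕ} (hnD : (nD : ℝ) - 1 ≤ D / ϱ)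
    (hθ : ∀ N : ℕ, ∑ n ∈ Finset.Ico nD N, ((n : ℝ) * (24 * (n : ℝ) ^ 2 + 2)) * (7 * (n : ℝ) / max D (c₀ * n) ^ 8) ≤ θ) :
    SchemeDominatedOnP ϱ α a b w kingN kingZ (fun x => D < ‖bondVec a b w x‖) (fun _ => (1 + α) * θ) (fun _ => (1 + α⁻¹) * θ) := by
  have hP := isPathSystem_king hc hw hlip hϱ
  refine schemeDominatedOnP_remainder (g := fun n => 7 * (n : ℝ) / max D (c₀ * n) ^ 8) (M := fun n => (n : ℝ) * (24 * (n : ℝ) ^ 2 + 2))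
    hα (fun x _ i j hi hj h => king_simple x hi hj h) (fun x hx hDx => ?_) (fun x _ hDx => king_coef_le hc.le hw hD hDx)
    (fun n => div_nonneg (by positivity) (pow_nonneg (hD.le.trans (le_max_left _ _)) 8))
    (fun y n Y hY => king_multiplicity y n Y fun x hx => ⟨(hY x hx).2.2.1, (hY x hx).2.2.2⟩) hθ
  have h1 := lt_np_of_pathSystem hϱ0 hP hx hDx
  have h2 : (nD : ℝ) < (kingN x : ℝ) + 1 := by linarith
  have h3 : nD < kingN x + 1 := by exact_mod_cast h2
  omega

end Summit.AtomisticToContinuum.Crystallization.Theorems.ChartedZeroExcessLayeredLatticeLiouville
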